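import Literature.MathematicalPhysics.QuantumFieldTheory.LatticeGaugeStaticPotentialProofs
import Literature.MathematicalPhysics.QuantumFieldTheory.YangMillsOS
import HarnessLib

/-!
# Axis (hypercubic) symmetry of Wilson's lattice gauge theory: `ℤ^d` glue and the curvature species

Complements to §(B) of `LatticeGaugeStaticPotentialProofs` (coordinate permutations `sitePerm` /
`configPerm` of the torus `(ℤ/L)^d`, `sitePermZd` / `configPermZd` of `ℤ^d`, and the invariance
`wilsonMeasure_map_configPerm` of Wilson's torus measure), needed to transport the EXACT invariance
of the torus Wilson state under permutations of the coordinate axes to smeared local fields read on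
the periodic lift (`YangMillsOS`: `actionDensity`, `LatticeRep.curvature`, `torusLift`, `configShift`):

* `ℤ^d` glue: `sitePermZd` is additive (`sitePermZd_neg`, `sitePermZd_sub`), preserves the cube
  `box d L` (`sitePermZd_mem_box_iff`; as a bijection of `↥(box d L)` use
  `(sitePermZd π).subtypeEquiv fun x => (sitePermZd_mem_box_iff π L x).symm`), conjugates the translations
  (`configPermZd_configShift`: `P_π ∘ τ_v = τ_{π v} ∘ P_π`) and is intertwined with the torus
  permutation by the periodic lift (`configPermZd_torusLift`);
* plaquettes: the holonomy of the permuted configuration is the holonomy at the permuted corner in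
  the permuted plane (`plaquetteHolonomyZd_configPermZd`), exchanging the two directions inverts the
  holonomy (`plaquetteHolonomyZd_swap_eq_inv`), hence `Re tr ρ(U_{x,ji}) = Re tr ρ(U_{x,ij})` for a continuous
  representation of a compact group (`plaquetteObs_swap`, via `CompactGroup.re_trace_map_inv`);
* the pair-sum lemma `sum_sum_ite_lt_comp_perm`: `∑_{i<j} f (π i) (π j) = ∑_{i<j} f i j` for
  symmetric `f` (both are half the off-diagonal sum), whence the Wilson action density at the origin
  `∑_{i<j} Re tr ρ(U_{0,ij})` is invariant under `configPermZd π` (`actionDensity_configPermZd`) and so is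
  the curvature species, also when read at a translated corner of the periodic lift of a permuted torus
  configuration (`LatticeRep.curvature_F_configPermZd`, `LatticeRep.curvature_F_perm_torusLift`);
* the change of variables `∫ f (configPerm π U) dμ_{Λ,β} = ∫ f dμ_{Λ,β}` under Wilson's torus measure
  (`integral_comp_configPerm_wilsonMeasure`, from `wilsonMeasure_map_configPerm`);
* the continuum side: `(piLpCongrLeft 2 ℝ ℝ π)⁻¹ (a • x) = a • (sitePermZd π⁻¹ x)` for the embedded
  lattice point `x ↦ siteToE x ∈ ℝ^d` (`piLpCongrLeft_symm_smul_siteToE`).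

Everything here is elementary bookkeeping (Wilson 1974; E. Seiler, LNP 159 (1982) Ch. 1: the Wilson
action and the product Haar measure are invariant under the full hypercubic group). All statements are
proved; no definition is introduced.
-/

noncomputable section

open _root_.MeasureTheory Finset
open Literature.MathematicalPhysics.QuantumLattice Literature.Probability Literature.Probability.LatticeModels

namespace Literature.MathematicalPhysics.QuantumFieldTheory

/-! ### `ℤ^d`: permutations, translations, the cube, the periodic lift -/

section Zd

variable {d : ℕ}

/-- `sitePermZd` commutes with negation (it is additive). [folklore] -/
theorem sitePermZd_neg (π : Equiv.Perm (Fin d)) (x : LatticeModels.Site d) :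
    sitePermZd π (-x) = -sitePermZd π x := rfl

/-- `sitePermZd` commutes with subtraction (it is additive). [folklore] -/
theorem sitePermZd_sub (π : Equiv.Perm (Fin d)) (x y : LatticeModels.Site d) :
    sitePermZd π (x - y) = sitePermZd π x - sitePermZd π y := rfl

/-- `sitePermZd π⁻¹` is a left inverse of `sitePermZd π`. [folklore] -/
@[simp] theorem sitePermZd_symm_apply_apply (π : Equiv.Perm (Fin d)) (x : LatticeModels.Site d) :
    sitePermZd π.symm (sitePermZd π x) = x := by
  funext j
  simp only [sitePermZd_apply, Equiv.symm_symm, Equiv.symm_apply_apply]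

/-- `sitePermZd π⁻¹` is a right inverse of `sitePermZd π`. [folklore] -/
@[simp] theorem sitePermZd_apply_symm_apply (π : Equiv.Perm (Fin d)) (x : LatticeModels.Site d) :
    sitePermZd π (sitePermZd π.symm x) = x := by
  funext j
  simp only [sitePermZd_apply, Equiv.symm_symm, Equiv.apply_symm_apply]

/-- **The cube `{-L,…,L}^d` is invariant under permutations of the axes.** [folklore] -/
theorem sitePermZd_mem_box_iff (π : Equiv.Perm (Fin d)) (L : ℕ) (x : LatticeModels.Site d) :
    sitePermZd π x ∈ box d L ↔ x ∈ box d L := by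
  simp only [mem_box, sitePermZd_apply]
  exact π.symm.forall_congr_right (q := fun i => -(L : ℤ) ≤ x i ∧ x i ≤ L)

variable {G : Type*}

section Shift

variable [MeasurableSpace G]

/-- **Coordinate permutations conjugate the translations**:
`configPermZd π (τ_v V) = τ_{π v} (configPermZd π V)` (`(τ_v V)(x, i) = V(x - v, i)`). [folklore] -/
theorem configPermZd_configShift (π : Equiv.Perm (Fin d)) (v : LatticeModels.Site d) (V : LGConfig d G) :
    configPermZd π (configShift v V) = configShift (sitePermZd π v) (configPermZd π V) := by
  funext e
  simp only [configPermZd_apply, QuantumLattice.configShift_apply, sitePermZd_sub, sitePermZd_symm_apply_apply]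

/-- **The periodic lift intertwines the coordinate permutations** of `ℤ^d` and of the torus:
`configPermZd π (torusLift L U) = torusLift L (configPerm π U)` (pointwise form of
`toTorusObservable_comp_configPermZd`). [folklore] -/
theorem configPermZd_torusLift (L : ℕ) (π : Equiv.Perm (Fin d)) (U : GaugeConfig d L G) :
    configPermZd π (torusLift L U) = torusLift L (configPerm π U) :=
  congrFun (toTorusObservable_comp_configPermZd (G := G) L π (id : LGConfig d G → LGConfig d G)) U

end Shift

/-! ### Plaquettes of the permuted configuration -/

variable [Group G]

omit [Group G] in
/-- Plaquette holonomies of the permuted configuration on `ℤ^d`: the holonomy at `x` in the plane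
`(i, j)` of `configPermZd π U` is the holonomy of `U` at `π⁻¹ x` in the plane `(π⁻¹ i, π⁻¹ j)`. [folklore] -/
theorem plaquetteHolonomyZd_configPermZd [Group G] [MeasurableSpace G] (π : Equiv.Perm (Fin d))
    (U : LGConfig d G) (x : LatticeModels.Site d) (i j : Fin d) :
    plaquetteHolonomyZd (configPermZd π U) x i j =
      plaquetteHolonomyZd U (sitePermZd π.symm x) (π.symm i) (π.symm j) := by
  simp only [plaquetteHolonomyZd, configPermZd_apply, sitePermZd_add, sitePermZd_single]

/-- Exchanging the two directions inverts the plaquette holonomy on `ℤ^d`. [folklore] -/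
theorem plaquetteHolonomyZd_swap_eq_inv (U : LGConfig d G) (x : LatticeModels.Site d) (i j : Fin d) :
    plaquetteHolonomyZd U x j i = (plaquetteHolonomyZd U x i j)⁻¹ := by
  simp only [plaquetteHolonomyZd, mul_inv_rev, inv_inv, mul_assoc]

variable {N : ℕ} (ρ : G →* Matrix (Fin N) (Fin N) ℂ)

/-- The plaquette observable of the permuted configuration. [folklore] -/
theorem plaquetteObs_configPermZd [MeasurableSpace G] (π : Equiv.Perm (Fin d)) (x : LatticeModels.Site d)
    (i j : Fin d) (U : LGConfig d G) :
    plaquetteObs ρ x i j (configPermZd π U) =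
      plaquetteObs ρ (sitePermZd π.symm x) (π.symm i) (π.symm j) U := by
  simp only [plaquetteObs, plaquetteHolonomyZd_configPermZd]

variable [TopologicalSpace G] [IsTopologicalGroup G] [CompactSpace G]

/-- **The plaquette observable is symmetric in its two directions** for a continuous representation of
a compact group: `Re tr ρ(U_{x,ji}) = Re tr ρ(U_{x,ij}⁻¹) = Re tr ρ(U_{x,ij})`
(`CompactGroup.re_trace_map_inv`). [folklore] -/
theorem plaquetteObs_swap (hρ : Continuous ρ) (x : LatticeModels.Site d) (i j : Fin d) (U : LGConfig d G) :
    plaquetteObs ρ x j i U = plaquetteObs ρ x i j U := by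
  simp only [plaquetteObs, plaquetteHolonomyZd_swap_eq_inv U x i j,
    Literature.RepresentationTheory.CompactGroups.CompactGroup.re_trace_map_inv ρ hρ]

end Zd

/-! ### Sums over ordered pairs of axes -/

/-- **Pair sums of a symmetric function are invariant under relabelling the axes**:
`∑_{i<j} f (π i) (π j) = ∑_{i<j} f i j` for symmetric `f` and a permutation `π` — twice either side
is the off-diagonal sum `∑_{i ≠ j} f i j`, which is re-indexed by `π`. [folklore] -/
theorem sum_sum_ite_lt_comp_perm {d : ℕ} (f : Fin d → Fin d → ℝ) (hsymm : ∀ i j, f i j = f j i)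
    (π : Equiv.Perm (Fin d)) :
    ∑ i, ∑ j, (if i < j then f (π i) (π j) else 0) = ∑ i, ∑ j, (if i < j then f i j else 0) := by
  -- twice the pair sum of a symmetric function is its off-diagonal sum
  have key : ∀ g : Fin d → Fin d → ℝ, (∀ i j, g i j = g j i) →
      2 * ∑ i, ∑ j, (if i < j then g i j else 0) = ∑ i, ∑ j, (if i ≠ j then g i j else 0) := by
    intro g hg
    have hswap : ∑ i, ∑ j, (if i < j then g i j else 0) = ∑ i, ∑ j, (if j < i then g i j else 0) := by
      rw [Finset.sum_comm]
      refine Finset.sum_congr rfl fun i _ => Finset.sum_congr rfl fun j _ => ?_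
      split_ifs
      · exact hg _ _
      · rfl
    rw [two_mul]
    nth_rewrite 2 [hswap]
    rw [← Finset.sum_add_distrib]
    refine Finset.sum_congr rfl fun i _ => ?_
    rw [← Finset.sum_add_distrib]
    refine Finset.sum_congr rfl fun j _ => ?_
    rcases lt_trichotomy i j with h | rfl | h
    · simp [h, not_lt.2 h.le, h.ne]
    · simp
    · simp [h, not_lt.2 h.le, h.ne']
  have hoff : ∑ i, ∑ j, (if i ≠ j then f (π i) (π j) else 0) = ∑ i, ∑ j, (if i ≠ j then f i j else 0) := by
    calc ∑ i, ∑ j, (if i ≠ j then f (π i) (π j) else 0)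
        = ∑ i, ∑ j, (if π i ≠ π j then f (π i) (π j) else 0) := by
          simp only [ne_eq, EmbeddingLike.apply_eq_iff_eq]
      _ = ∑ i, ∑ j, (if i ≠ j then f i j else 0) :=
          Fintype.sum_equiv π _ _ fun i => Fintype.sum_equiv π _ _ fun j => rfl
  have h1 := key (fun i j => f (π i) (π j)) fun i j => hsymm _ _
  have h2 := key f hsymm
  linarith [h1, h2, hoff]

/-! ### The action density and the curvature species under axis permutations -/

section Density

variable {G : Type} [Group G] {N : ℕ} (ρ : G →* Matrix (Fin N) (Fin N) ℂ)
variable [TopologicalSpace G] [IsTopologicalGroup G] [CompactSpace G]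

/-- **The Wilson action density at the origin is invariant under permutations of the axes**:
`∑_{i<j} Re tr ρ((P_π V)_{0,ij}) = ∑_{i<j} Re tr ρ(V_{0,ij})` for a continuous representation of a compact
group (the six planes at the origin are permuted, a reversed orientation costs an inversion of the
holonomy, invisible to `Re tr ρ`). [folklore] -/
theorem actionDensity_configPermZd [MeasurableSpace G] (hρ : Continuous ρ) (π : Equiv.Perm (Fin 4))
    (V : LGConfig 4 G) : actionDensity ρ (configPermZd π V) = actionDensity ρ V := by
  unfold actionDensity
  simp only [plaquetteObs_configPermZd, sitePermZd_zero]
  exact sum_sum_ite_lt_comp_perm (fun i j => plaquetteObs ρ 0 i j V)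
    (fun i j => plaquetteObs_swap ρ hρ 0 j i V) π.symm

variable [MeasurableSpace G] [BorelSpace G]

/-- **The curvature species is invariant under permutations of the axes** (`r.curvature.F` is the
action density in the representation `r.ρ`). [folklore] -/
theorem LatticeRep.curvature_F_configPermZd (r : LatticeRep G) (π : Equiv.Perm (Fin 4)) (V : LGConfig 4 G) :
    r.curvature.F (configPermZd π V) = r.curvature.F V :=
  actionDensity_configPermZd r.ρ r.continuous π V

/-- **The curvature at the permuted corner of the lift of the permuted torus configuration is the
curvature at the corner**: `P(τ_{π y} (P_π U)~) = P(τ_y Ũ)` (`Ũ = torusLift S U`, `τ_y = configShift (-y)`).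
[folklore] -/
theorem LatticeRep.curvature_F_perm_torusLift (r : LatticeRep G) (S : ℕ) (π : Equiv.Perm (Fin 4))
    (y : LatticeModels.Site 4) (U : GaugeConfig 4 S G) :
    r.curvature.F (configShift (-(sitePermZd π y)) (torusLift S (configPerm π U))) =
      r.curvature.F (configShift (-y) (torusLift S U)) := by
  rw [← configPermZd_torusLift, ← sitePermZd_neg, ← configPermZd_configShift,
    LatticeRep.curvature_F_configPermZd]

end Density

/-! ### Change of variables under Wilson's torus measure -/

section Torus

variable {d L N : ℕ} [NeZero L] {G : Type*} [Group G] [TopologicalSpace G] [IsTopologicalGroup G]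
  [CompactSpace G] [MeasurableSpace G] [BorelSpace G] (ρ : G →* Matrix (Fin N) (Fin N) ℂ)

/-- `configPerm π` preserves Wilson's torus measure (every torus, every `β`; continuous `ρ`). [folklore] -/
theorem measurePreserving_configPerm_wilsonMeasure (hρ : Continuous ρ) (β : ℝ) (π : Equiv.Perm (Fin d)) :
    MeasurePreserving (configPerm π) (wilsonMeasure (d := d) (L := L) (G := G) ρ β) (wilsonMeasure ρ β) :=
  ⟨(configPerm π).measurable, wilsonMeasure_map_configPerm ρ hρ β π⟩

/-- **Change of variables under a permutation of the axes**:
`∫ f (configPerm π U) dμ_{Λ,β}(U) = ∫ f dμ_{Λ,β}` for Wilson's torus measure. [folklore] -/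
theorem integral_comp_configPerm_wilsonMeasure (hρ : Continuous ρ) (β : ℝ) (π : Equiv.Perm (Fin d))
    {E : Type*} [NormedAddCommGroup E] [NormedSpace ℝ E] (f : GaugeConfig d L G → E) :
    ∫ U, f (configPerm π U) ∂(wilsonMeasure ρ β) = ∫ U, f U ∂(wilsonMeasure (d := d) (L := L) ρ β) :=
  (measurePreserving_configPerm_wilsonMeasure ρ hρ β π).integral_comp' f

end Torus

/-! ### The continuum side: permuting the coordinates of an embedded lattice point -/

/-- **The inverse coordinate permutation of a scaled lattice point**: for the linear isometry
`R_π = piLpCongrLeft 2 ℝ ℝ π` of `ℝ^d` (`(R_π v)_j = v_{π⁻¹ j}`) and the embedding `siteToE : ℤ^d → ℝ^d`,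
`R_π⁻¹ (a • x) = a • (sitePermZd π⁻¹ x)`. [folklore] -/
theorem piLpCongrLeft_symm_smul_siteToE {d : ℕ} (π : Equiv.Perm (Fin d)) (a : ℝ) (x : LatticeModels.Site d) :
    (LinearIsometryEquiv.piLpCongrLeft 2 ℝ ℝ π).symm (a • siteToE x) = a • siteToE (sitePermZd π.symm x) := by
  ext j
  simp [LinearIsometryEquiv.piLpCongrLeft_apply, sitePermZd_apply]

end Literature.MathematicalPhysics.QuantumFieldTheory

end
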